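import Mathlib
import Summits.CriticalPhenomena.SAWScalingLimit.Theorems.SAWDefectDecoherenceSectorSlavingDefs
import Summits.CriticalPhenomena.SAWScalingLimit.Theorems.SAWDefectDecoherenceDefectDecoherenceTmStarSums
import HarnessLib

/-!
# Tip regrouping, auxiliary file 2: splitting the walks to a mid-edge of `v` by their last vertex
(helpers for the stub `stub_tipRegrouping` of the line `sector-slaving`, crux `DefectDecoherence`,
stmt-CriticalPhenomena-8549)

For a root `s(u,w)` with `u ∉ Λ` and a mid-edge `s(t,v)` with `t, v ∈ Λ`, every walk
`γ : s(u,w) → s(t,v)` is nontrivial and its last vertex is `t` ("via-`t`": the walk arrives at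
`mid{t,v}` pointing INTO `v`) or `v` ("via-`v`") — `tip_sum_split_last`.  The via-`v` walks are in
bijection with the triples `(s, ω, t)`: `s ∈ star Λ v`, `ω : s(u,w) → s(s,v)` a CLEAN ARRIVAL at `v`
through the dart `s → v` (last vertex `s`, `v ∉ ω`), `t ≠ s`; the bijection appends `v`
(`tip_exists_snoc`, `tip_exists_trunc`), whence the re-summation identity `tip_sum_viaV` for
arbitrary functionals of the vertex list.

Sources: H. Duminil-Copin, S. Smirnov, Ann. of Math. 175 (2012) (arXiv:1007.0575), §2 (proof of
Lemma 1: pairs and triplets of walks); the line card `Lines/sector-slaving.md`.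
-/

noncomputable section

open scoped BigOperators ComplexConjugate Classical
open Literature.Probability.LatticeModels Literature.Probability.RandomPlanarGeometry.SAW
open Summit.CriticalPhenomena.SAWScalingLimit.Theorems.DefectDecoherence.TipMartingale

namespace Summit.CriticalPhenomena.SAWScalingLimit.Theorems.DefectDecoherence.SectorSlaving

variable {Λ : Finset HexVertex} {u w v t : HexVertex}

/-! ### Nontriviality and the last-vertex dichotomy -/

/-- Membership in the star, unfolded. [folklore] -/
theorem tip_mem_star {s : HexVertex} : s ∈ star Λ v ↔ s ∈ Λ ∧ hexGraph.Adj v s := by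
  simp [TipMartingale.star]

/-- A walk from `s(u,w)` (`u ∉ Λ`) to a mid-edge `s(t,v)` with `t, v ∈ Λ` visits a vertex. [folklore] -/
theorem tip_verts_ne_nil (hu : u ∉ Λ) (hv : v ∈ Λ) (ht : t ∈ Λ)
    (γ : HexMidEdgeSAW Λ s(u, w) s(t, v)) : γ.verts ≠ [] := by
  intro h
  have e := γ.eq_of_nil h
  have hm : u ∈ s(t, v) := by rw [← e]; exact Sym2.mem_mk_left u w
  rcases Sym2.mem_iff.1 hm with rfl | rfl
  · exact hu ht
  · exact hu hv

/-- **Last-vertex dichotomy**: a sum over the walks `s(u,w) → s(t,v)` splits into the via-`t` walks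
(last vertex `t`) and the via-`v` walks (last vertex `v`). [folklore] -/
theorem tip_sum_split_last {M : Type*} [AddCommMonoid M] (hu : u ∉ Λ) (hv : v ∈ Λ) (ht : t ∈ Λ)
    (htv : t ≠ v) (f : HexMidEdgeSAW Λ s(u, w) s(t, v) → M) :
    ∑ γ, f γ = (∑ γ, if γ.verts.getLast? = some t then f γ else 0) +
      ∑ γ, if γ.verts.getLast? = some v then f γ else 0 := by
  rw [← Finset.sum_add_distrib]
  refine Finset.sum_congr rfl fun γ _ => ?_
  have hne := tip_verts_ne_nil hu hv ht γ
  have hl := γ.getLast_mem _ (List.getLast?_eq_some_getLast hne)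
  rw [List.getLast?_eq_some_getLast hne]
  rcases Sym2.mem_iff.1 hl with h | h
  · rw [h, if_pos rfl, if_neg (fun e => htv (Option.some_injective _ e)), add_zero]
  · rw [h, if_neg (fun e => htv (Option.some_injective _ e).symm), if_pos rfl, zero_add]

/-! ### Appending and removing the vertex `v` -/

/-- **Prolongation by `v`.** A clean arrival `ω : s(u,w) → s(s,v)` at `v` through the dart `s → v`
(last vertex `s`, `v ∉ ω`) extends, for every other neighbour `t ≠ s` of `v` in `Λ`, to the walk
`ω ++ [v] : s(u,w) → s(t,v)` (the new edges `{s,v}` and the final half-edge `{t,v}` are fresh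
because `v` is). [folklore] -/
theorem tip_exists_snoc (hu : u ∉ Λ) (hv : v ∈ Λ) {s : HexVertex} (hs : s ∈ star Λ v)
    (ht : t ∈ star Λ v) (hst : s ≠ t) (ω : HexMidEdgeSAW Λ s(u, w) s(s, v))
    (hlast : ω.verts.getLast? = some s) (hvω : v ∉ ω.verts) :
    ∃ γ : HexMidEdgeSAW Λ s(u, w) s(t, v), γ.verts = ω.verts ++ [v] := by
  obtain ⟨hsΛ, hvs⟩ := tip_mem_star.1 hs
  obtain ⟨htΛ, hvt⟩ := tip_mem_star.1 ht
  have hne : ω.verts ≠ [] := by rintro h; simp [h] at hlast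
  have hlast' : ω.verts.getLast hne = s :=
    Option.some_injective _ ((List.getLast?_eq_some_getLast hne).symm.trans hlast)
  have hab : s(u, w) ≠ s(t, v) := fun e => by
    have hm : u ∈ s(t, v) := by rw [← e]; exact Sym2.mem_mk_left u w
    rcases Sym2.mem_iff.1 hm with rfl | rfl
    · exact hu htΛ
    · exact hu hv
  refine ⟨
    { verts := ω.verts ++ [v]
      subset := ?_
      nodup := ?_
      isChain := ?_
      head_mem := ?_
      getLast_mem := ?_
      eq_of_nil := ?_
      edges_nodup := ?_
      fst_mem := ω.fst_mem }, rfl⟩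
  · intro x hx
    rcases List.mem_append.1 hx with h | h
    · exact ω.subset x h
    · rw [List.mem_singleton.1 h]; exact hv
  · refine List.nodup_append.2 ⟨ω.nodup, List.nodup_singleton v, fun x hx y hy hxy => ?_⟩
    rw [List.mem_singleton.1 hy] at hxy
    exact hvω (hxy ▸ hx)
  · refine List.IsChain.append ω.isChain (List.isChain_singleton v) fun x hx y hy => ?_
    rw [hlast] at hx
    cases hx; cases hy
    exact hvs.symm
  · intro x hx
    apply ω.head_mem
    rw [List.head?_append, List.head?_eq_some_head hne, Option.some_or] at hx
    rwa [List.head?_eq_some_head hne]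
  · intro x hx
    rw [List.getLast?_append, List.getLast?_singleton, Option.some_or, Option.some.injEq] at hx
    rw [← hx]; exact Sym2.mem_mk_right _ _
  · intro h; simp at h
  · intro _
    rw [edges_append _ _ hne (List.cons_ne_nil _ _), hlast']
    simp only [List.head_cons]
    have e : s(u, w) :: (List.zipWith (fun u w => s(u, w)) ω.verts ω.verts.tail ++
        s(s, v) :: List.zipWith (fun u w => s(u, w)) [v] [v].tail) ++ [s(t, v)] =
        (s(u, w) :: List.zipWith (fun u w => s(u, w)) ω.verts ω.verts.tail ++ [s(s, v)]) ++
          [s(t, v)] := by simp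
    rw [e, List.nodup_append]
    refine ⟨ω.edges_nodup hne, List.nodup_singleton _, fun x hx y hy hxy => ?_⟩
    rw [List.mem_singleton.1 hy] at hxy
    subst hxy
    rcases List.mem_cons.1 hx with h | h
    · exact hab h.symm
    rcases List.mem_append.1 h with h | h
    · exact hvω (forall_mem_of_mem_edges _ _ h v (Sym2.mem_mk_right t v))
    · rw [List.mem_singleton] at h
      rcases Sym2.eq_iff.1 h with ⟨h1, -⟩ | ⟨h1, -⟩
      · exact hst h1.symm
      · exact hvt.ne h1.symm

/-- **Truncation.** A via-`v` walk `γ : s(u,w) → s(t,v)` (last vertex `v`; `u ∉ Λ ∋ v`, `w ≠ v`)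
visits at least two vertices; removing `v` leaves a clean arrival `ω` at `v` through the dart
`s → v` of its last-but-one vertex `s ∈ star Λ v`, `s ≠ t` (the edge `{s,v}` and the final
half-edge `{t,v}` of `γ` are distinct). [folklore] -/
theorem tip_exists_trunc (hu : u ∉ Λ) (hv : v ∈ Λ) (hwv : w ≠ v) (ht : t ∈ star Λ v)
    (γ : HexMidEdgeSAW Λ s(u, w) s(t, v)) (hlast : γ.verts.getLast? = some v) :
    ∃ s ∈ star Λ v, s ≠ t ∧ ∃ ω : HexMidEdgeSAW Λ s(u, w) s(s, v),
      ω.verts.getLast? = some s ∧ v ∉ ω.verts ∧ γ.verts = ω.verts ++ [v] := by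
  obtain ⟨htΛ, _⟩ := tip_mem_star.1 ht
  have hne : γ.verts ≠ [] := tip_verts_ne_nil hu hv htΛ γ
  have hL : γ.verts = γ.verts.dropLast ++ [v] := (List.dropLast_append_getLast? v hlast).symm
  -- the walk visits a vertex before `v`
  have hL0 : γ.verts.dropLast ≠ [] := by
    intro h0
    rw [h0, List.nil_append] at hL
    have hm := γ.head_mem v (by rw [hL]; rfl)
    rcases Sym2.mem_iff.1 hm with e | e
    · exact hu (e ▸ hv)
    · exact hwv e.symm
  obtain ⟨L, s, hLs⟩ : ∃ L s, γ.verts.dropLast = L ++ [s] :=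
    ⟨_, _, (List.dropLast_append_getLast hL0).symm⟩
  rw [hLs] at hL
  -- `hL : γ.verts = L ++ [s] ++ [v]`
  have hch := γ.isChain
  rw [hL, List.append_assoc, List.singleton_append, List.isChain_append_cons_cons] at hch
  obtain ⟨hch1, hsv, -⟩ := hch
  have hnd := γ.nodup
  rw [hL, List.nodup_append] at hnd
  obtain ⟨hnd1, -, hdis⟩ := hnd
  have hvL : v ∉ L ++ [s] := fun h => hdis v h v (List.mem_singleton_self v) rfl
  have hsΛ : s ∈ Λ := γ.subset s (by rw [hL]; simp)
  have hs : s ∈ star Λ v := tip_mem_star.2 ⟨hsΛ, hsv.symm⟩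
  -- the edge list of `γ`
  have hE := γ.edges_nodup hne
  have hne1 : L ++ [s] ≠ [] := by simp
  rw [hL, edges_append _ _ hne1 (List.cons_ne_nil _ _), List.getLast_append_singleton] at hE
  simp only [List.head_cons] at hE
  have e : s(u, w) :: (List.zipWith (fun u w => s(u, w)) (L ++ [s]) (L ++ [s]).tail ++
      s(s, v) :: List.zipWith (fun u w => s(u, w)) [v] [v].tail) ++ [s(t, v)] =
      (s(u, w) :: List.zipWith (fun u w => s(u, w)) (L ++ [s]) (L ++ [s]).tail ++ [s(s, v)]) ++
        [s(t, v)] := by simp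
  rw [e, List.nodup_append] at hE
  obtain ⟨hE1, -, hEdis⟩ := hE
  have hst : s ≠ t := fun h =>
    hEdis (s(s, v)) (by simp) (s(t, v)) (List.mem_singleton_self _) (by rw [h])
  refine ⟨s, hs, hst,
    { verts := L ++ [s]
      subset := fun x hx => γ.subset x (by rw [hL]; exact List.mem_append_left _ hx)
      nodup := hnd1
      isChain := hch1
      head_mem := ?_
      getLast_mem := ?_
      eq_of_nil := fun h => (hne1 h).elim
      edges_nodup := fun _ => hE1
      fst_mem := γ.fst_mem }, by simp, hvL, hL⟩
  · intro x hx
    apply γ.head_mem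
    rw [hL, List.head?_append, hx]
    rfl
  · intro x hx
    rw [List.getLast?_append, List.getLast?_singleton, Option.some_or, Option.some.injEq] at hx
    rw [← hx]; exact Sym2.mem_mk_left _ _

/-- Extensionality for the pairs (dart, walk). [folklore] -/
theorem tip_sigma_ext {x y : (s : HexVertex) × HexMidEdgeSAW Λ s(u, w) s(s, v)}
    (h1 : x.1 = y.1) (h2 : x.2.verts = y.2.verts) : x = y := by
  obtain ⟨s, ω⟩ := x
  obtain ⟨s', ω'⟩ := y
  dsimp only at h1 h2
  subst h1
  obtain rfl : ω = ω' := HexMidEdgeSAW.ext h2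
  rfl

/-- **The via-`v` bijection as a sum identity.** For `u ∉ Λ ∋ v`, `w ≠ v`, `t ∈ star Λ v` and any
functional `Ψ` of the vertex list: summing `Ψ` over the via-`v` walks `s(u,w) → s(t,v)` is summing
`Ψ(ω ++ [v])` over the darts `s → v` (`s ∈ star Λ v`, `s ≠ t`) and the clean arrivals `ω` at `v`
through them. [folklore] -/
theorem tip_sum_viaV {M : Type*} [AddCommMonoid M] (hu : u ∉ Λ) (hv : v ∈ Λ) (hwv : w ≠ v)
    (ht : t ∈ star Λ v) (Ψ : List HexVertex → M) :
    ∑ γ : HexMidEdgeSAW Λ s(u, w) s(t, v), (if γ.verts.getLast? = some v then Ψ γ.verts else 0) =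
      ∑ s ∈ star Λ v, ∑ ω : HexMidEdgeSAW Λ s(u, w) s(s, v),
        if ω.verts.getLast? = some s ∧ v ∉ ω.verts then
          (if s = t then 0 else Ψ (ω.verts ++ [v])) else 0 := by
  -- both sides are sums of `Ψ` over finite sets of vertex lists
  set A : Finset (List HexVertex) :=
    (Finset.univ.filter fun γ : HexMidEdgeSAW Λ s(u, w) s(t, v) =>
      γ.verts.getLast? = some v).image fun γ => γ.verts with hA
  set T : Finset ((s : HexVertex) × HexMidEdgeSAW Λ s(u, w) s(s, v)) :=
    (star Λ v).sigma fun s => Finset.univ.filter fun ω =>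
      (ω.verts.getLast? = some s ∧ v ∉ ω.verts) ∧ s ≠ t with hT
  set B : Finset (List HexVertex) := T.image fun x => x.2.verts ++ [v] with hB
  have hLHS : ∑ γ : HexMidEdgeSAW Λ s(u, w) s(t, v),
      (if γ.verts.getLast? = some v then Ψ γ.verts else 0) = ∑ l ∈ A, Ψ l := by
    rw [hA, Finset.sum_image fun x _ y _ h => HexMidEdgeSAW.ext h, Finset.sum_filter]
  have hRHS : (∑ s ∈ star Λ v, ∑ ω : HexMidEdgeSAW Λ s(u, w) s(s, v),
      if ω.verts.getLast? = some s ∧ v ∉ ω.verts then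
        (if s = t then 0 else Ψ (ω.verts ++ [v])) else 0) = ∑ l ∈ B, Ψ l := by
    rw [hB, Finset.sum_image, hT, Finset.sum_sigma]
    · refine Finset.sum_congr rfl fun s _ => ?_
      rw [Finset.sum_filter]
      refine Finset.sum_congr rfl fun ω _ => ?_
      by_cases h1 : ω.verts.getLast? = some s ∧ v ∉ ω.verts
      · by_cases h2 : s = t
        · rw [if_pos h1, if_pos h2, if_neg (fun h => h.2 h2)]
        · rw [if_pos h1, if_neg h2, if_pos ⟨h1, h2⟩]
      · rw [if_neg h1, if_neg (fun h => h1 h.1)]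
    · intro x hx y hy hxy
      have h2 : x.2.verts = y.2.verts := List.append_cancel_right hxy
      refine tip_sigma_ext ?_ h2
      have hx' := (Finset.mem_sigma.1 hx).2
      have hy' := (Finset.mem_sigma.1 hy).2
      simp only [Finset.mem_filter, Finset.mem_univ, true_and] at hx' hy'
      have e := hx'.1.1
      rw [h2, hy'.1.1] at e
      exact (Option.some_injective _ e).symm
  rw [hLHS, hRHS]
  -- the two sets of lists coincide
  congr 1
  ext l
  simp only [hA, hB, Finset.mem_image, Finset.mem_filter, Finset.mem_univ, true_and]
  constructor
  · rintro ⟨γ, hγ, rfl⟩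
    obtain ⟨s, hs, hst, ω, hω1, hω2, hω3⟩ := tip_exists_trunc hu hv hwv ht γ hγ
    exact ⟨⟨s, ω⟩, Finset.mem_sigma.2 ⟨hs, by simp [hω1, hω2, hst]⟩, hω3.symm⟩
  · rintro ⟨⟨s, ω⟩, hx, rfl⟩
    obtain ⟨hs, hω⟩ := Finset.mem_sigma.1 hx
    simp only [Finset.mem_filter, Finset.mem_univ, true_and] at hω
    obtain ⟨γ, hγ⟩ := tip_exists_snoc hu hv hs ht hω.2 ω hω.1.1 hω.1.2
    exact ⟨γ, by rw [hγ]; simp, hγ⟩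

/-! ### Registered helper -/

/-- **Registered helper `tip_viaV_split`** (the via-`v` bijection as a sum identity for complex
functionals of the vertex list). [folklore] -/
theorem tip_viaV_split : ∀ (Λ : Finset HexVertex) (u w v t : HexVertex),
    u ∉ Λ → v ∈ Λ → w ≠ v → t ∈ star Λ v → ∀ Ψ : List HexVertex → ℂ,
      ∑ γ : HexMidEdgeSAW Λ s(u, w) s(t, v),
          (if γ.verts.getLast? = some v then Ψ γ.verts else 0) =
        ∑ s ∈ star Λ v, ∑ ω : HexMidEdgeSAW Λ s(u, w) s(s, v),
          if ω.verts.getLast? = some s ∧ v ∉ ω.verts then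
            (if s = t then 0 else Ψ (ω.verts ++ [v])) else 0 :=
  fun _ _ _ _ _ hu hv hwv ht Ψ => tip_sum_viaV hu hv hwv ht Ψ

end Summit.CriticalPhenomena.SAWScalingLimit.Theorems.DefectDecoherence.SectorSlaving

end
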